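import Summits.KontsevichZagierPeriods.Zeta5Search.Certificates.TwoTaleTelescopeGR

/-!
# (bmiss)@Ω — cert-2's certificate atoms of direction `g`, side `R`, evaluated (cell `pub-zeta5`, cert-1 gen 4)

HONEST FRAMING: systematic search; recurrence certificates; no irrationality claim unless certified. Pure algebra over `ℚ`.

Values of the opaque atoms of `Certificates.TwoTaleTelescope.telescope_g_R` at `t = u/2` (`u` the lattice variable): the Γ-ratio
linear-form products `lprod numGRk/denGRk/tnGR/tdGR/cnumGR/cnumSGR/cdenGR/cdenSGR` (note the `t`-free factors `(g−b+j)`), and the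
`t`-free certificate numerator `x_R` (`xGRv`, `polyTN_xGR`). (Side `L` of direction `g` is fam-tele's `TwoTaleOmega/StepGL`.)
-/

noncomputable section

open Polynomial
open Summit.KontsevichZagierPeriods.Zeta5Search.Certificates.TwoTaleTelescope

namespace Summit.KontsevichZagierPeriods.Zeta5Search.TwoTaleOmega

/-- Value of cert-2's atom `lprod numGR1` at `t = u/2`. -/
theorem numGR1_eval (a b e f g u : ℚ) : lprod numGR1 a b e f g (u / 2) = (a - b + g + u) := by
  simp only [lprod_cons, lprod_nil, lval, numGR1, List.getD_cons_zero, List.getD_cons_succ]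
  push_cast; ring

/-- Value of cert-2's atom `lprod numGR2` at `t = u/2`. -/
theorem numGR2_eval (a b e f g u : ℚ) : lprod numGR2 a b e f g (u / 2) = (a - b + g + u) * (a - b + g + u + 1) := by
  simp only [lprod_cons, lprod_nil, lval, numGR2, List.getD_cons_zero, List.getD_cons_succ]
  push_cast; ring

/-- Value of cert-2's atom `lprod numGR3` at `t = u/2`. -/
theorem numGR3_eval (a b e f g u : ℚ) : lprod numGR3 a b e f g (u / 2) = (a - b + g + u) * (a - b + g + u + 1) * (a - b + g + u + 2) := by
  simp only [lprod_cons, lprod_nil, lval, numGR3, List.getD_cons_zero, List.getD_cons_succ]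
  push_cast; ring

/-- Value of cert-2's atom `lprod denGR1` at `t = u/2`. -/
theorem denGR1_eval (a b e f g u : ℚ) : lprod denGR1 a b e f g (u / 2) = (-b + g) * (g + u / 2) := by
  simp only [lprod_cons, lprod_nil, lval, denGR1, List.getD_cons_zero, List.getD_cons_succ]
  push_cast; ring

/-- Value of cert-2's atom `lprod denGR2` at `t = u/2`. -/
theorem denGR2_eval (a b e f g u : ℚ) : lprod denGR2 a b e f g (u / 2) = (-b + g) * (-b + g + 1) * (g + u / 2) * (g + u / 2 + 1) := by
  simp only [lprod_cons, lprod_nil, lval, denGR2, List.getD_cons_zero, List.getD_cons_succ]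
  push_cast; ring

/-- Value of cert-2's atom `lprod denGR3` at `t = u/2`. -/
theorem denGR3_eval (a b e f g u : ℚ) : lprod denGR3 a b e f g (u / 2) = (-b + g) * (-b + g + 1) * (-b + g + 2) * (g + u / 2) * (g + u / 2 + 1) * (g + u / 2 + 2) := by
  simp only [lprod_cons, lprod_nil, lval, denGR3, List.getD_cons_zero, List.getD_cons_succ]
  push_cast; ring

/-- Value of cert-2's atom `lprod tnGR` at `t = u/2`. -/
theorem tnGR_eval (a b e f g u : ℚ) : lprod tnGR a b e f g (u / 2) = (a - b + g + u) * (a - b + g + u + 1) * (a + u / 2) * (e + u / 2) * (f + u / 2) := by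
  simp only [lprod_cons, lprod_nil, lval, tnGR, List.getD_cons_zero, List.getD_cons_succ]
  push_cast; ring

/-- Value of cert-2's atom `lprod tdGR` at `t = u/2`. -/
theorem tdGR_eval (a b e f g u : ℚ) : lprod tdGR a b e f g (u / 2) = (a + u + 1) * (a + u + 2) * (a - b + u / 2 + 1) * (e + f + u / 2) * (g + u / 2) := by
  simp only [lprod_cons, lprod_nil, lval, tdGR, List.getD_cons_zero, List.getD_cons_succ]
  push_cast; ring

/-- Value of cert-2's atom `lprod cnumGR` at `t = u/2`. -/
theorem cnumGR_eval (a b e f g u : ℚ) : lprod cnumGR a b e f g (u / 2) = (a + u - 1) * (a + u) * (a - b + u / 2) * (e + f + u / 2 - 1) * (g + u / 2 + 2) := by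
  simp only [lprod_cons, lprod_nil, lval, cnumGR, List.getD_cons_zero, List.getD_cons_succ]
  push_cast; ring

/-- Value of cert-2's atom `lprod cnumSGR` at `t = u/2`. -/
theorem cnumSGR_eval (a b e f g u : ℚ) : lprod cnumSGR a b e f g (u / 2) = (a + u + 1) * (a + u + 2) * (a - b + u / 2 + 1) * (e + f + u / 2) * (g + u / 2 + 3) := by
  simp only [lprod_cons, lprod_nil, lval, cnumSGR, List.getD_cons_zero, List.getD_cons_succ]
  push_cast; ring

/-- Value of cert-2's atom `lprod cdenGR` at `t = u/2`. -/
theorem cdenGR_eval (a b e f g u : ℚ) : lprod cdenGR a b e f g (u / 2) = (g + u / 2) * (-b + g) * (g + u / 2 + 1) * (-b + g + 1) * (g + u / 2 + 2) * (-b + g + 2) := by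
  simp only [lprod_cons, lprod_nil, lval, cdenGR, List.getD_cons_zero, List.getD_cons_succ]
  push_cast; ring

/-- Value of cert-2's atom `lprod cdenSGR` at `t = u/2`. -/
theorem cdenSGR_eval (a b e f g u : ℚ) : lprod cdenSGR a b e f g (u / 2) = (g + u / 2 + 1) * (-b + g) * (g + u / 2 + 2) * (-b + g + 1) * (g + u / 2 + 3) * (-b + g + 2) := by
  simp only [lprod_cons, lprod_nil, lval, cdenSGR, List.getD_cons_zero, List.getD_cons_succ]
  push_cast; ring

/-- The (t-free) side-`R` certificate numerator `x_R(a,b,e,f,g)` of direction `g`. -/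
def xGRv (a b e f g : ℚ) : ℚ := spvalC (xGR.getD 0 []) a b e f g

/-- cert-2's atom `polyTN xGR s` is the constant `x_R`. -/
theorem polyTN_xGR (s : ℤ) (a b e f g t : ℚ) : polyTN xGR s a b e f g t = xGRv a b e f g := by
  have hl : xGR.length = 1 := rfl
  simp [polyTN, hl, xGRv]

end Summit.KontsevichZagierPeriods.Zeta5Search.TwoTaleOmega

end
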